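import Mathlib.LinearAlgebra.Matrix.Permanent
import Mathlib.Data.Matrix.Block
import Mathlib.Data.Fintype.Perm
import Mathlib.Logic.Equiv.Option
import Mathlib.Data.Finset.Powerset
import Mathlib.Algebra.BigOperators.Ring.Finset
import Mathlib.Algebra.BigOperators.Fin
import Literature.LinearAlgebra.Matrix.PermanentLaplace
import HarnessLib

/-!
# Subpermanents and the Laplace expansion theorem for permanents (BCS 1997, (21.30))

A second permanent toolkit (companion of `PermanentLaplace.lean`), built for the gadget proofs
of Valiant's completeness theorem (Bürgisser–Clausen–Shokrollahi 1997, Thm. (21.29)), whose key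
tool is the **Laplace Expansion Theorem** for permanents, BCS (21.30): for a square matrix `A`
indexed by `Z` and a partition `Z = Z₁ ⊔ Z₂` of the rows,
`per A = ∑_{S₁ ⊔ S₂ = Z, |S_j| = |Z_j|} per(A ↓ Z₁ × S₁) · per(A ↓ Z₂ × S₂)`.
We phrase the restricted permanents `per(A ↓ rows × cols)` as `Matrix.subperm M p q` — the sum,
over all bijections `f` from the columns satisfying `p` to the rows satisfying `q`, of
`∏ M (f i) i` (Mathlib's column-major convention `per M = ∑_σ ∏_i M (σ i) i`) — so that repeated
expansions stay inside one ambient index type (the predicates accumulate, the matrix does not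
change).

* `Matrix.subperm`, `subperm_congr`, `subperm_true` (`= per`), `subperm_of_isEmpty` (`= 1`),
  `subperm_eq_zero_of_col` / `_of_row` (a zero column/row), `subperm_eq_permanent_of_equiv` and
  `subperm_range_eq_permanent` (evaluation as an honest `Matrix.permanent` after enumerating
  rows and columns).
* `subperm_expand_row`, `subperm_expand_row_support`: expansion along one row (the bijections
  grouped by the column sent to that row; `subpermRestrict` / `subpermExtend` realise the fibres).
* `subperm_laplace`: BCS (21.30) for two parts, by induction on the row set; `subperm_laplace_support`
  (only column sets inside the support of the rows, and containing every column supported inside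
  the rows, contribute) and `subperm_laplace_forced` (the single-term case used for gadgets).
* `permanent_fromBlocks_zero₂₁` (`per (A B; 0 D) = per A · per D`, the permanent twin of
  `Matrix.det_fromBlocks_zero₂₁`), and the explicit expansions `permanent_fin_two_row`,
  `permanent_fin_three_row`, `permanent_fin_four_row`.

## Design notes

* Deliberate dot-notation extensions of Mathlib's `Matrix` namespace; Mathlib has no Laplace
  expansion for permanents (searched `permanent_`, `Laplace`; `Matrix.det_fromBlocks_zero₂₁`,
  `Matrix.det_succ_row` are the determinant versions). `Literature/Computability/Complexity/
  OccurrenceObstructionsFresh.lean` has `permanent_fin_two'`/`permanent_fin_three'` (column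
  expansion) behind a heavy import list; the row expansions here are restated Mathlib-only.
* Everything holds over a commutative semiring.

## References

* P. Bürgisser, M. Clausen, M. A. Shokrollahi, *Algebraic Complexity Theory*, Grundlehren 315,
  Springer 1997, (21.30) Laplace Expansion Theorem and its proof (shuffle permutations), p. 560–561.
* H. Minc, *Permanents*, Encyclopedia of Mathematics and its Applications 6, Addison-Wesley 1978,
  §1.2 (Laplace expansion for permanents). (Not held.)
-/

namespace Matrix

open Equiv Finset

variable {ι : Type*} [Fintype ι] [DecidableEq ι] {R : Type*} [CommSemiring R]

/-- The **subpermanent** of `M` on the columns satisfying `p` and the rows satisfying `q`: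
`∑_{f} ∏_{i : p i} M (f i) i`, the sum over all bijections `f` from the `p`-columns to the
`q`-rows (so it is `0` unless the two sets have the same size, and `per M` for `p = q = ⊤`,
`Matrix.subperm_true`). This is `per(A ↓ Z × S)` of BCS 1997, (21.30), for `Z = {q}`,
`S = {p}`, in Mathlib's column-major convention `per M = ∑_σ ∏_i M (σ i) i`. [cite: BurgisserClausenShokrollahi1997, (21.30)] -/
def subperm (M : Matrix ι ι R) (p q : ι → Prop) [DecidablePred p] [DecidablePred q] : R :=
  ∑ f : {i // p i} ≃ {j // q j}, ∏ i : {i // p i}, M (f i) i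

variable (M : Matrix ι ι R)

/-- The subpermanent only depends on the two index sets. [folklore] -/
theorem subperm_congr {p p' q q' : ι → Prop} [DecidablePred p] [DecidablePred p']
    [DecidablePred q] [DecidablePred q'] (hp : ∀ i, p i ↔ p' i) (hq : ∀ j, q j ↔ q' j) :
    M.subperm p q = M.subperm p' q' := by
  have hp' : p = p' := funext fun i => propext (hp i)
  have hq' : q = q' := funext fun j => propext (hq j)
  subst hp' hq'
  congr

/-- The subpermanent on all rows and all columns is the permanent. [cite: BurgisserClausenShokrollahi1997, (21.30)] -/
theorem subperm_true : M.subperm (fun _ => True) (fun _ => True) = M.permanent := by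
  unfold subperm permanent
  let e : {i : ι // True} ≃ ι := Equiv.subtypeUnivEquiv fun _ => trivial
  refine Fintype.sum_equiv (Equiv.equivCongr e e) _ _ fun f => ?_
  refine Fintype.prod_equiv e _ _ fun i => ?_
  simp [Equiv.equivCongr_apply_apply, e]

/-- A subpermanent with a zero column vanishes. [folklore] -/
theorem subperm_eq_zero_of_col {p q : ι → Prop} [DecidablePred p] [DecidablePred q] (i₀ : ι)
    (hi₀ : p i₀) (h : ∀ j, q j → M j i₀ = 0) : M.subperm p q = 0 :=
  Finset.sum_eq_zero fun f _ =>
    Finset.prod_eq_zero (Finset.mem_univ ⟨i₀, hi₀⟩) (h _ (f ⟨i₀, hi₀⟩).2)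

/-- A subpermanent with a zero row vanishes. [folklore] -/
theorem subperm_eq_zero_of_row {p q : ι → Prop} [DecidablePred p] [DecidablePred q] (j₀ : ι)
    (hj₀ : q j₀) (h : ∀ i, p i → M j₀ i = 0) : M.subperm p q = 0 :=
  Finset.sum_eq_zero fun f _ => by
    refine Finset.prod_eq_zero (Finset.mem_univ (f.symm ⟨j₀, hj₀⟩)) ?_
    rw [Equiv.apply_symm_apply]
    exact h _ (f.symm ⟨j₀, hj₀⟩).2

/-- Evaluation: after enumerating the `p`-columns and the `q`-rows by `Fin n`, the subpermanent is
the permanent of the corresponding `n × n` matrix. [folklore] -/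
theorem subperm_eq_permanent_of_equiv {p q : ι → Prop} [DecidablePred p] [DecidablePred q]
    {κ : Type*} [Fintype κ] [DecidableEq κ] (ec : κ ≃ {i // p i}) (er : κ ≃ {j // q j}) :
    M.subperm p q = (Matrix.of fun a b : κ => M (er a) (ec b)).permanent := by
  unfold subperm permanent
  symm
  refine Fintype.sum_equiv (Equiv.equivCongr ec er) _ _ fun σ => ?_
  refine Fintype.prod_equiv ec _ _ fun b => ?_
  simp [Equiv.equivCongr_apply_apply]

/-! ### Expansion along one row -/

section Row

variable {p q : ι → Prop} {i j₀ : ι} (hpi : p i) (hj₀ : q j₀)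

omit [Fintype ι] [DecidableEq ι] in
/-- Restricting a bijection `f` from the `p`-columns to the `q`-rows with `f i = j₀` to the
other columns and rows. [folklore] -/
def subpermRestrict (f : {i // p i} ≃ {j // q j}) (hf : f ⟨i, hpi⟩ = ⟨j₀, hj₀⟩) :
    {x // p x ∧ x ≠ i} ≃ {y // q y ∧ y ≠ j₀} where
  toFun x := ⟨f ⟨x, x.2.1⟩, (f ⟨x, x.2.1⟩).2, fun h => x.2.2 (by
    have h' : f ⟨x, x.2.1⟩ = f ⟨i, hpi⟩ := by rw [hf]; exact Subtype.ext h
    exact congrArg Subtype.val (f.injective h'))⟩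
  invFun y := ⟨f.symm ⟨y, y.2.1⟩, (f.symm ⟨y, y.2.1⟩).2, fun h => y.2.2 (by
    have h' : f.symm ⟨y, y.2.1⟩ = ⟨i, hpi⟩ := Subtype.ext h
    have h'' : (⟨y, y.2.1⟩ : {j // q j}) = ⟨j₀, hj₀⟩ := by
      rw [← hf, ← h', Equiv.apply_symm_apply]
    exact congrArg Subtype.val h'')⟩
  left_inv x := Subtype.ext (by simp)
  right_inv y := Subtype.ext (by simp)

omit [Fintype ι] [DecidableEq ι] in
/-- Values of the restriction. [folklore] -/
@[simp] theorem subpermRestrict_apply_coe (f : {i // p i} ≃ {j // q j}) (hf : f ⟨i, hpi⟩ = ⟨j₀, hj₀⟩)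
    (x : {x // p x ∧ x ≠ i}) : (subpermRestrict hpi hj₀ f hf x : ι) = f ⟨x, x.2.1⟩ := rfl

omit [Fintype ι] in
/-- Extending a bijection between the other columns and rows by `i ↦ j₀`. [folklore] -/
def subpermExtend (g : {x // p x ∧ x ≠ i} ≃ {y // q y ∧ y ≠ j₀}) : {i // p i} ≃ {j // q j} where
  toFun x := if h : (x : ι) = i then ⟨j₀, hj₀⟩ else ⟨g ⟨x, x.2, h⟩, (g ⟨x, x.2, h⟩).2.1⟩
  invFun y := if h : (y : ι) = j₀ then ⟨i, hpi⟩ else ⟨g.symm ⟨y, y.2, h⟩, (g.symm ⟨y, y.2, h⟩).2.1⟩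
  left_inv x := by
    by_cases h : (x : ι) = i
    · apply Subtype.ext
      simp [h]
    · have h2 : ((g ⟨x, x.2, h⟩ : {y // q y ∧ y ≠ j₀}) : ι) ≠ j₀ := (g ⟨x, x.2, h⟩).2.2
      apply Subtype.ext
      simp only [dif_neg h]
      rw [dif_neg h2]
      simp
  right_inv y := by
    by_cases h : (y : ι) = j₀
    · apply Subtype.ext
      simp [h]
    · have h2 : ((g.symm ⟨y, y.2, h⟩ : {x // p x ∧ x ≠ i}) : ι) ≠ i := (g.symm ⟨y, y.2, h⟩).2.2
      apply Subtype.ext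
      simp only [dif_neg h]
      rw [dif_neg h2]
      simp

omit [Fintype ι] in
/-- The extension sends `i` to `j₀`. [folklore] -/
theorem subpermExtend_apply_self (g : {x // p x ∧ x ≠ i} ≃ {y // q y ∧ y ≠ j₀}) :
    subpermExtend hpi hj₀ g ⟨i, hpi⟩ = ⟨j₀, hj₀⟩ := by
  apply Subtype.ext; simp [subpermExtend]

omit [Fintype ι] in
/-- The extension agrees with `g` elsewhere. [folklore] -/
theorem subpermExtend_apply_of_ne (g : {x // p x ∧ x ≠ i} ≃ {y // q y ∧ y ≠ j₀}) (x : {i // p i})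
    (hx : (x : ι) ≠ i) : (subpermExtend hpi hj₀ g x : ι) = g ⟨x, x.2, hx⟩ := by
  simp [subpermExtend, hx]

/-- **Expansion of a subpermanent along the row `j₀`**: group the bijections by the column sent to
`j₀`. [cite: BurgisserClausenShokrollahi1997, (21.30)] -/
theorem subperm_expand_row [DecidablePred p] [DecidablePred q] (M : Matrix ι ι R) (j₀ : ι)
    (hj₀ : q j₀) :
    M.subperm p q = ∑ i ∈ univ.filter p,
      M j₀ i * M.subperm (fun i' => p i' ∧ i' ≠ i) (fun j => q j ∧ j ≠ j₀) := by
  classical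
  unfold subperm
  -- group by the column `i` with `f i = j₀`
  rw [← Finset.sum_fiberwise_of_maps_to
    (g := fun f : {i // p i} ≃ {j // q j} => (f.symm ⟨j₀, hj₀⟩ : ι)) (t := univ.filter p)
    (fun f _ => Finset.mem_filter.2 ⟨Finset.mem_univ _, (f.symm ⟨j₀, hj₀⟩).2⟩)]
  refine Finset.sum_congr rfl fun i hi => ?_
  rw [Finset.mem_filter] at hi
  obtain ⟨-, hpi⟩ := hi
  have hfib : ∀ f : {i // p i} ≃ {j // q j}, ((f.symm ⟨j₀, hj₀⟩ : ι) = i) ↔ f ⟨i, hpi⟩ = ⟨j₀, hj₀⟩ := by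
    intro f
    constructor
    · intro h
      have h' : f.symm ⟨j₀, hj₀⟩ = ⟨i, hpi⟩ := Subtype.ext h
      rw [← h', Equiv.apply_symm_apply]
    · intro h
      rw [← h, Equiv.symm_apply_apply]
  rw [Finset.mul_sum]
  refine Finset.sum_bij' (fun f hf => subpermRestrict hpi hj₀ f ((hfib f).1 (Finset.mem_filter.1 hf).2))
    (fun g _ => subpermExtend hpi hj₀ g) ?_ ?_ ?_ ?_ ?_
  · intro f _; exact Finset.mem_univ _
  · intro g _
    exact Finset.mem_filter.2 ⟨Finset.mem_univ _, (hfib _).2 (subpermExtend_apply_self hpi hj₀ g)⟩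
  · intro f hf
    have hfi := (hfib f).1 (Finset.mem_filter.1 hf).2
    ext x
    by_cases hx : (x : ι) = i
    · have : x = ⟨i, hpi⟩ := Subtype.ext hx
      subst this
      rw [subpermExtend_apply_self, hfi]
    · rw [subpermExtend_apply_of_ne hpi hj₀ _ _ hx, subpermRestrict_apply_coe]
  · intro g _
    ext x
    rw [subpermRestrict_apply_coe, subpermExtend_apply_of_ne hpi hj₀ _ _ x.2.2]
  · intro f hf
    have hfi := (hfib f).1 (Finset.mem_filter.1 hf).2
    -- split the product at the column `i`
    rw [← Finset.mul_prod_erase _ _ (Finset.mem_univ ⟨i, hpi⟩), congrArg Subtype.val hfi]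
    congr 1
    refine Finset.prod_bij' (fun x hx => ⟨x.1, x.2, fun h => (Finset.mem_erase.1 hx).1 (Subtype.ext h)⟩)
      (fun x _ => ⟨x.1, x.2.1⟩) ?_ ?_ ?_ ?_ ?_
    · intro x _; exact Finset.mem_univ _
    · intro x _; exact Finset.mem_erase.2 ⟨fun h => x.2.2 (congrArg Subtype.val h), Finset.mem_univ _⟩
    · intro x _; rfl
    · intro x _; rfl
    · intro x _; rfl

/-- Expansion of a subpermanent along a row `j₀` supported in a set `T` of columns. [cite: BurgisserClausenShokrollahi1997, (21.30)] -/
theorem subperm_expand_row_support [DecidablePred p] [DecidablePred q] (M : Matrix ι ι R) (j₀ : ι)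
    (hj₀ : q j₀) (T : Finset ι) (hT : ∀ i, p i → i ∉ T → M j₀ i = 0) :
    M.subperm p q = ∑ i ∈ T.filter p,
      M j₀ i * M.subperm (fun i' => p i' ∧ i' ≠ i) (fun j => q j ∧ j ≠ j₀) := by
  rw [M.subperm_expand_row j₀ hj₀]
  symm
  refine Finset.sum_subset (fun i hi => ?_) (fun i hi hi' => ?_)
  · exact Finset.mem_filter.2 ⟨Finset.mem_univ _, (Finset.mem_filter.1 hi).2⟩
  · have hpi : p i := (Finset.mem_filter.1 hi).2
    rw [hT i hpi (fun h => hi' (Finset.mem_filter.2 ⟨h, hpi⟩)), zero_mul]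

end Row

/-! ### The Laplace expansion along a set of rows (BCS 1997, (21.30)) -/

section Laplace

/-- The subpermanent on two empty index sets is `1` (the empty bijection). [folklore] -/
theorem subperm_of_isEmpty {p q : ι → Prop} [DecidablePred p] [DecidablePred q]
    (hp : ∀ i, ¬ p i) (hq : ∀ j, ¬ q j) : M.subperm p q = 1 := by
  haveI : IsEmpty {i // p i} := ⟨fun x => hp x x.2⟩
  haveI : IsEmpty {j // q j} := ⟨fun y => hq y y.2⟩
  haveI : Unique ({i // p i} ≃ {j // q j}) :=
    { default := Equiv.equivOfIsEmpty _ _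
      uniq := fun f => Equiv.ext fun x => isEmptyElim x }
  unfold subperm
  rw [Fintype.sum_unique, Fintype.prod_empty]

/-- **Laplace expansion theorem for permanents** (BCS 1997, (21.30), for a partition into two
parts, in the form of subpermanents): for a set `B` of rows,
`subperm p q = ∑_{S} subperm (· ∈ S) (· ∈ B) · subperm (p ∧ · ∉ S) (q ∧ · ∉ B)`, the sum over the
sets `S` of `p`-columns with `|S| = |B|`. Proof by induction on `B`, peeling one row with
`subperm_expand_row` and regrouping the pairs `(i, S')` as `(insert i S', i)`. [cite: BurgisserClausenShokrollahi1997, (21.30)] -/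
theorem subperm_laplace {p q : ι → Prop} [DecidablePred p] [DecidablePred q] (B : Finset ι)
    (hB : ∀ j ∈ B, q j) :
    M.subperm p q = ∑ S ∈ (univ.filter p).powersetCard B.card,
      M.subperm (· ∈ S) (· ∈ B) * M.subperm (fun i => p i ∧ i ∉ S) (fun j => q j ∧ j ∉ B) := by
  induction B using Finset.induction_on generalizing p q with
  | empty =>
    rw [Finset.card_empty, Finset.powersetCard_zero, Finset.sum_singleton,
      M.subperm_of_isEmpty (p := (· ∈ (∅ : Finset ι))) (q := (· ∈ (∅ : Finset ι))) (by simp) (by simp),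
      one_mul]
    exact M.subperm_congr (fun i => by simp) (fun j => by simp)
  | insert j₀ B' hj₀ ih =>
    have hqj₀ : q j₀ := hB j₀ (Finset.mem_insert_self _ _)
    have hB' : ∀ j ∈ B', q j ∧ j ≠ j₀ := fun j hj =>
      ⟨hB j (Finset.mem_insert_of_mem hj), fun h => hj₀ (h ▸ hj)⟩
    -- expand along the row `j₀`, then apply the induction hypothesis inside
    rw [M.subperm_expand_row j₀ hqj₀]
    have step : ∀ i ∈ univ.filter p,
        M j₀ i * M.subperm (fun i' => p i' ∧ i' ≠ i) (fun j => q j ∧ j ≠ j₀) =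
        ∑ S' ∈ (univ.filter fun i' => p i' ∧ i' ≠ i).powersetCard B'.card,
          M j₀ i * (M.subperm (· ∈ S') (· ∈ B') *
            M.subperm (fun i' => (p i' ∧ i' ≠ i) ∧ i' ∉ S') (fun j => (q j ∧ j ≠ j₀) ∧ j ∉ B')) := by
      intro i _
      rw [ih hB', Finset.mul_sum]
    rw [Finset.sum_congr rfl step, Finset.sum_sigma', Finset.card_insert_of_notMem hj₀]
    -- the right-hand side: expand each block factor along the row `j₀`
    have step' : ∀ S ∈ (univ.filter p).powersetCard (B'.card + 1),
        M.subperm (· ∈ S) (· ∈ insert j₀ B') *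
          M.subperm (fun i => p i ∧ i ∉ S) (fun j => q j ∧ j ∉ insert j₀ B') =
        ∑ i ∈ S, M j₀ i * (M.subperm (· ∈ S.erase i) (· ∈ B') *
          M.subperm (fun i' => p i' ∧ i' ∉ S) (fun j => q j ∧ j ∉ insert j₀ B')) := by
      intro S _
      rw [M.subperm_expand_row (p := (· ∈ S)) (q := (· ∈ insert j₀ B')) j₀ (Finset.mem_insert_self _ _),
        Finset.sum_mul, Finset.filter_mem_eq_inter, Finset.univ_inter]
      refine Finset.sum_congr rfl fun i hi => ?_
      rw [mul_assoc]
      congr 2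
      exact M.subperm_congr (fun i' => by simp [Finset.mem_erase, and_comm])
        (fun j => by
          simp only [Finset.mem_insert]
          constructor
          · rintro ⟨h | h, hne⟩
            · exact absurd h hne
            · exact h
          · intro h
            exact ⟨Or.inr h, fun h' => hj₀ (h' ▸ h)⟩)
    rw [Finset.sum_congr rfl step', Finset.sum_sigma']
    -- reindex the pairs `(i, S')` as `(insert i S', i)`
    refine Finset.sum_bij' (fun x _ => ⟨insert x.1 x.2, x.1⟩) (fun y _ => ⟨y.2, y.1.erase y.2⟩)
      ?_ ?_ ?_ ?_ ?_
    · rintro ⟨i, S'⟩ hx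
      simp only [Finset.mem_sigma, Finset.mem_filter, Finset.mem_univ, true_and,
        Finset.mem_powersetCard] at hx ⊢
      obtain ⟨hpi, hS', hcard⟩ := hx
      have hiS' : i ∉ S' := fun h => ((Finset.mem_filter.1 (hS' h)).2).2 rfl
      refine ⟨⟨fun x hx => ?_, ?_⟩, Finset.mem_insert_self _ _⟩
      · rcases Finset.mem_insert.1 hx with rfl | hx
        · exact Finset.mem_filter.2 ⟨Finset.mem_univ _, hpi⟩
        · exact Finset.mem_filter.2 ⟨Finset.mem_univ _, (Finset.mem_filter.1 (hS' hx)).2.1⟩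
      · rw [Finset.card_insert_of_notMem hiS', hcard]
    · rintro ⟨S, i⟩ hy
      simp only [Finset.mem_sigma, Finset.mem_filter, Finset.mem_univ, true_and,
        Finset.mem_powersetCard] at hy ⊢
      obtain ⟨⟨hS, hcard⟩, hiS⟩ := hy
      refine ⟨(Finset.mem_filter.1 (hS hiS)).2, fun x hx => ?_, ?_⟩
      · rw [Finset.mem_erase] at hx
        exact Finset.mem_filter.2 ⟨Finset.mem_univ _, (Finset.mem_filter.1 (hS hx.2)).2, hx.1⟩
      · rw [Finset.card_erase_of_mem hiS, hcard, Nat.add_sub_cancel]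
    · rintro ⟨i, S'⟩ hx
      simp only [Finset.mem_sigma, Finset.mem_filter, Finset.mem_univ, true_and,
        Finset.mem_powersetCard] at hx
      have hiS' : i ∉ S' := fun h => ((Finset.mem_filter.1 (hx.2.1 h)).2).2 rfl
      simp [Finset.erase_insert hiS']
    · rintro ⟨S, i⟩ hy
      simp only [Finset.mem_sigma, Finset.mem_powersetCard] at hy
      simp [Finset.insert_erase hy.2]
    · rintro ⟨i, S'⟩ hx
      simp only [Finset.mem_sigma, Finset.mem_filter, Finset.mem_univ, true_and,
        Finset.mem_powersetCard] at hx
      have hiS' : i ∉ S' := fun h => ((Finset.mem_filter.1 (hx.2.1 h)).2).2 rfl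
      dsimp only
      rw [Finset.erase_insert hiS']
      congr 2
      exact M.subperm_congr
        (fun i' => by
          simp only [Finset.mem_insert, not_or]
          tauto)
        (fun j => by
          simp only [Finset.mem_insert, not_or]
          tauto)

/-- **Laplace expansion with supports**: in `subperm_laplace`, only the column sets `S` inside the
support `T` of the rows `B` and containing every column `F ∋ i` whose support lies inside the
rows `B` contribute. [cite: BurgisserClausenShokrollahi1997, (21.30)] -/
theorem subperm_laplace_support {p q : ι → Prop} [DecidablePred p] [DecidablePred q]
    (B : Finset ι) (hB : ∀ j ∈ B, q j) (T : Finset ι)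
    (hT : ∀ j ∈ B, ∀ i, p i → i ∉ T → M j i = 0) (F : Finset ι) (hFp : ∀ i ∈ F, p i)
    (hF : ∀ i ∈ F, ∀ j, q j → j ∉ B → M j i = 0) :
    M.subperm p q = ∑ S ∈ ((T.filter p).powersetCard B.card).filter (fun S => F ⊆ S),
      M.subperm (· ∈ S) (· ∈ B) * M.subperm (fun i => p i ∧ i ∉ S) (fun j => q j ∧ j ∉ B) := by
  rw [M.subperm_laplace B hB]
  symm
  refine Finset.sum_subset (fun S hS => ?_) (fun S hS hS' => ?_)
  · simp only [Finset.mem_filter, Finset.mem_powersetCard] at hS ⊢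
    exact ⟨fun x hx => Finset.mem_filter.2 ⟨Finset.mem_univ _, (Finset.mem_filter.1 (hS.1.1 hx)).2⟩,
      hS.1.2⟩
  · simp only [Finset.mem_filter, Finset.mem_powersetCard, not_and_or] at hS hS'
    rcases hS' with (hS' | hS') | hS'
    · -- a column of `S` outside the support `T`
      obtain ⟨z, hzS, hzT⟩ := Finset.not_subset.1 hS'
      have hpz : p z := (Finset.mem_filter.1 (hS.1 hzS)).2
      have hzT' : z ∉ T := fun h => hzT (Finset.mem_filter.2 ⟨h, hpz⟩)
      rw [M.subperm_eq_zero_of_col (p := (· ∈ S)) (q := (· ∈ B)) z hzS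
        (fun j hj => hT j hj z hpz hzT'), zero_mul]
    · exact absurd hS.2 hS'
    · -- a forced column not in `S`
      obtain ⟨i, hiF, hiS⟩ := Finset.not_subset.1 hS'
      rw [M.subperm_eq_zero_of_col (p := fun i => p i ∧ i ∉ S) (q := fun j => q j ∧ j ∉ B) i
        ⟨hFp i hiF, hiS⟩ (fun j hj => hF i hiF j hj.1 hj.2), mul_zero]

/-- **Forced Laplace expansion**: if moreover `|F| + 1 = |B|` and every admissible extra column
`z ≠ z₀` gives a vanishing block subpermanent, then the expansion along the rows `B` has the
single term `S = insert z₀ F`. [cite: BurgisserClausenShokrollahi1997, (21.30)] -/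
theorem subperm_laplace_forced {p q : ι → Prop} [DecidablePred p] [DecidablePred q]
    (B : Finset ι) (hB : ∀ j ∈ B, q j) (T : Finset ι)
    (hT : ∀ j ∈ B, ∀ i, p i → i ∉ T → M j i = 0) (F : Finset ι) (hFp : ∀ i ∈ F, p i)
    (hF : ∀ i ∈ F, ∀ j, q j → j ∉ B → M j i = 0) (hFT : F ⊆ T) (hcard : F.card + 1 = B.card)
    (z₀ : ι) (hz₀T : z₀ ∈ T) (hpz₀ : p z₀) (hz₀F : z₀ ∉ F)
    (hzero : ∀ z ∈ T, p z → z ∉ F → z ≠ z₀ → M.subperm (· ∈ insert z F) (· ∈ B) = 0) :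
    M.subperm p q = M.subperm (· ∈ insert z₀ F) (· ∈ B) *
      M.subperm (fun i => p i ∧ i ∉ insert z₀ F) (fun j => q j ∧ j ∉ B) := by
  rw [M.subperm_laplace_support B hB T hT F hFp hF]
  have hmem : insert z₀ F ∈ ((T.filter p).powersetCard B.card).filter (fun S => F ⊆ S) := by
    simp only [Finset.mem_filter, Finset.mem_powersetCard]
    refine ⟨⟨fun x hx => ?_, ?_⟩, Finset.subset_insert _ _⟩
    · rcases Finset.mem_insert.1 hx with rfl | hx
      · exact Finset.mem_filter.2 ⟨hz₀T, hpz₀⟩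
      · exact Finset.mem_filter.2 ⟨hFT hx, hFp x hx⟩
    · rw [Finset.card_insert_of_notMem hz₀F, hcard]
  rw [Finset.sum_eq_single_of_mem _ hmem]
  intro S hS hne
  simp only [Finset.mem_filter, Finset.mem_powersetCard] at hS
  obtain ⟨⟨hST, hScard⟩, hFS⟩ := hS
  -- `S = insert z F` for the unique `z ∈ S \ F`
  have hsd : (S \ F).card = 1 := by
    rw [Finset.card_sdiff_of_subset hFS, hScard, ← hcard, Nat.add_sub_cancel_left]
  obtain ⟨z, hz⟩ := Finset.card_eq_one.1 hsd
  have hzS : z ∈ S ∧ z ∉ F := by rw [← Finset.mem_sdiff, hz]; exact Finset.mem_singleton_self _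
  have hS : S = insert z F := by
    rw [← Finset.sdiff_union_of_subset hFS, hz]; rfl
  have hzT : z ∈ T ∧ p z := Finset.mem_filter.1 (hST hzS.1)
  have hzz₀ : z ≠ z₀ := fun h => hne (by rw [hS, h])
  rw [hS, hzero z hzT.1 hzT.2 hzS.2 hzz₀, zero_mul]

/-- Evaluation of a block subpermanent: with the columns enumerated by an injective `v` and the
rows by an injective `w` (both `Fin n → ι`), it is the permanent of the `n × n` matrix
`(M (w a) (v b))_{a,b}`. [folklore] -/
theorem subperm_range_eq_permanent {κ : Type*} [Fintype κ] [DecidableEq κ] (v w : κ → ι)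
    (hv : Function.Injective v) (hw : Function.Injective w) :
    M.subperm (· ∈ Set.range v) (· ∈ Set.range w) =
      (Matrix.of fun a b : κ => M (w a) (v b)).permanent := by
  rw [M.subperm_eq_permanent_of_equiv (Equiv.ofInjective v hv) (Equiv.ofInjective w hw)]
  rfl

end Laplace


/-! ### Block triangular matrices and small explicit permanents -/

section Blocks

omit [Fintype ι] [DecidableEq ι]

/-- **The permanent of a block upper triangular matrix** is the product of the permanents of the
diagonal blocks: `per (A B; 0 D) = per A · per D` (the columns of the first block are supported
in its rows, so the Laplace expansion along those rows has a single term; the permanent twin of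
`Matrix.det_fromBlocks_zero₂₁`). [folklore] -/
theorem permanent_fromBlocks_zero₂₁ {m n : Type*} [Fintype m] [DecidableEq m] [Fintype n]
    [DecidableEq n] (A : Matrix m m R) (B : Matrix m n R) (D : Matrix n n R) :
    (Matrix.fromBlocks A B 0 D).permanent = A.permanent * D.permanent := by
  classical
  set M := Matrix.fromBlocks A B 0 D with hM
  set F : Finset (m ⊕ n) := univ.map ⟨Sum.inl, Sum.inl_injective⟩ with hF
  have hmemF : ∀ x, x ∈ F ↔ ∃ a, Sum.inl a = x := fun x => by simp [hF]
  rw [← M.subperm_true, M.subperm_laplace_support F (fun _ _ => trivial) univ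
    (fun _ _ i _ hi => absurd (Finset.mem_univ i) hi) F (fun _ _ => trivial)
    (fun i hi j _ hj => by
      obtain ⟨a, rfl⟩ := (hmemF i).1 hi
      rcases j with j | j
      · exact absurd ((hmemF _).2 ⟨j, rfl⟩) hj
      · simp [hM])]
  have hsingle : ((univ.filter fun _ : m ⊕ n => True).powersetCard F.card).filter (fun S => F ⊆ S)
      = {F} := by
    ext S
    simp only [Finset.mem_filter, Finset.mem_powersetCard, Finset.mem_singleton, Finset.filter_true]
    constructor
    · rintro ⟨⟨-, hcard⟩, hFS⟩
      exact (Finset.eq_of_subset_of_card_le hFS hcard.le).symm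
    · rintro rfl
      exact ⟨⟨Finset.subset_univ _, rfl⟩, Finset.Subset.refl _⟩
  rw [hsingle, Finset.sum_singleton]
  have h1 : M.subperm (· ∈ F) (· ∈ F) = A.permanent := by
    rw [M.subperm_congr (p' := (· ∈ Set.range Sum.inl)) (q' := (· ∈ Set.range Sum.inl))
      (fun i => by rw [hmemF, Set.mem_range]) (fun j => by rw [hmemF, Set.mem_range]),
      M.subperm_range_eq_permanent Sum.inl Sum.inl Sum.inl_injective Sum.inl_injective]
    congr 1
  have h2 : M.subperm (fun i => True ∧ i ∉ F) (fun j => True ∧ j ∉ F) = D.permanent := by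
    rw [M.subperm_congr (p' := (· ∈ Set.range Sum.inr)) (q' := (· ∈ Set.range Sum.inr))
      (fun i => by rcases i with i | i <;> simp [hmemF]) (fun j => by rcases j with j | j <;> simp [hmemF]),
      M.subperm_range_eq_permanent Sum.inr Sum.inr Sum.inr_injective Sum.inr_injective]
    congr 1
  rw [h1, h2]

/-- The permanent of a `2 × 2` matrix (expansion along row `0`). [folklore] -/
theorem permanent_fin_two_row (A : Matrix (Fin 2) (Fin 2) R) :
    permanent A = A 0 0 * A 1 1 + A 0 1 * A 1 0 := by
  rw [permanent_eq_sum_row_zero, Fin.sum_univ_two, permanent_unique, permanent_unique]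
  simp [submatrix_apply, Fin.succAbove, Fin.default_eq_zero]

/-- The permanent of a `3 × 3` matrix (expansion along row `0`). [folklore] -/
theorem permanent_fin_three_row (A : Matrix (Fin 3) (Fin 3) R) :
    permanent A = A 0 0 * (A 1 1 * A 2 2 + A 1 2 * A 2 1) +
      A 0 1 * (A 1 0 * A 2 2 + A 1 2 * A 2 0) + A 0 2 * (A 1 0 * A 2 1 + A 1 1 * A 2 0) := by
  rw [permanent_eq_sum_row_zero, Fin.sum_univ_three, permanent_fin_two_row, permanent_fin_two_row,
    permanent_fin_two_row]
  simp [submatrix_apply, Fin.succAbove]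

/-- The permanent of a `4 × 4` matrix (expansion along row `0`, then `permanent_fin_three_row`).
[folklore] -/
theorem permanent_fin_four_row (A : Matrix (Fin 4) (Fin 4) R) :
    permanent A =
      A 0 0 * (A 1 1 * (A 2 2 * A 3 3 + A 2 3 * A 3 2) + A 1 2 * (A 2 1 * A 3 3 + A 2 3 * A 3 1) +
          A 1 3 * (A 2 1 * A 3 2 + A 2 2 * A 3 1)) +
      A 0 1 * (A 1 0 * (A 2 2 * A 3 3 + A 2 3 * A 3 2) + A 1 2 * (A 2 0 * A 3 3 + A 2 3 * A 3 0) +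
          A 1 3 * (A 2 0 * A 3 2 + A 2 2 * A 3 0)) +
      A 0 2 * (A 1 0 * (A 2 1 * A 3 3 + A 2 3 * A 3 1) + A 1 1 * (A 2 0 * A 3 3 + A 2 3 * A 3 0) +
          A 1 3 * (A 2 0 * A 3 1 + A 2 1 * A 3 0)) +
      A 0 3 * (A 1 0 * (A 2 1 * A 3 2 + A 2 2 * A 3 1) + A 1 1 * (A 2 0 * A 3 2 + A 2 2 * A 3 0) +
          A 1 2 * (A 2 0 * A 3 1 + A 2 1 * A 3 0)) := by
  rw [permanent_eq_sum_row_zero, Fin.sum_univ_four, permanent_fin_three_row,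
    permanent_fin_three_row, permanent_fin_three_row, permanent_fin_three_row]
  simp [submatrix_apply, Fin.succAbove]

end Blocks

end Matrix
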